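import Summits.ResolutionOfSingularities.ResolutionOfSingularities.Theorems.HilbertSamuelEliminationSigmaMaxModificationsCorridor3StrictTransformKernel
import Literature.AlgebraicGeometry.Resolution.BlowupSNC
import Literature.AlgebraicGeometry.Resolution.BlowupsIntegral
import Literature.AlgebraicGeometry.Resolution.RegularLocalRingsUFD
import Literature.AlgebraicGeometry.Resolution.RegularLocalRingsProofs
import Literature.AlgebraicGeometry.Resolution.AlterationsBoundaryDivisor
import Literature.AlgebraicGeometry.Resolution.AlterationsNormalFormBlowupParts
import Literature.AlgebraicGeometry.Resolution.CanonicalResolutionSmoothCentre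
import Mathlib.AlgebraicGeometry.Morphisms.SchemeTheoreticallyDominant
import Mathlib.AlgebraicGeometry.FunctionField
import Mathlib.RingTheory.UniqueFactorizationDomain.Basic
import Mathlib.RingTheory.Ideal.Colon
import Literature.AlgebraicGeometry.Resolution.RegularBlowup
import Literature.AlgebraicGeometry.Resolution.BlowupDimension
import Literature.AlgebraicGeometry.Resolution.HypersurfacePushforward
import HarnessLib

/-!
# `SigmaMaxModificationsCorridor3` (stmt-19249), line `tame_wild` v3: helper **T3 — the embedded
# tower** (part 2: strict transforms of Cartier divisors stay Cartier; the tower)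

[OURS · L1 W4.2] lead res-L1-w42-lead-1's brick T3 (`hT3` of the kernel assembly
`TameWild.confinedNu3_of_bricks`, p480768, signature verbatim: `stub_T3_embeddedTower`) of the
confined transfer `stub_confinedTameNu3_of_thor4` (crux `SigmaMaxModificationsCorridor3`
stmt-19249, parent `SigmaMaxModifications` stmt-18506); plan-1's row T-tow (CHAIN v3.1 §5);
replaces the role of "blow the ambient regular fourfold up along the centres of the sequence and
follow the hypersurface by strict transforms"; NOT a statement of any manuscript under review.

* `exists_iSup_colon_span_singleton_pow_eq_span` — in a UFD the saturation `⋃ₙ ((a) : (t)ⁿ)` of a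
  non-zero principal ideal is principal (induction on the prime factorisation of `a`).
* `isEffectiveCartier_strictTransformIdeal` — **the strict transform `⋃ₙ (π^*H : 𝓘(D)ⁿ)` of an
  effective Cartier divisor `V(H)` of an integral locally Noetherian `X` under a blow-up
  `π : X' → X` along `C ≠ 0` with `X'` REGULAR is a non-zero effective Cartier divisor**: its stalks
  are saturations of the (non-zero: `π` is dominant, `isDominant_of_isBlowup`) pulled-back equation
  by the exceptional equation (`stalkIdeal_strictTransformIdeal`) in the factorial local rings
  `𝒪_{X',x'}` (Auslander–Buchsbaum, tree `uniqueFactorizationMonoid_of_isRegularLocalRing`), and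
  stalkwise principal non-zero ideal sheaves are effective Cartier
  (`isEffectiveCartier_of_stalkIdeal_eq_span_singleton`). No hypothesis on the singularities of
  `V(H)` or on the position of the centre.
* `embeddedTower_step`, `embeddedTower`, `stub_T3_embeddedTower` — Kollár's push-forward tower
  (3.30.3; tree `blowup.pushforwardMap`, `CentreSeq`) of a regular-centred blow-up sequence of the
  hypersurface `U = V(I) ↪ Z` carries the package "regular integral `Z`, separated quasi-compact
  locally of finite type over `k`, `dim ≤ N`, `U ↪ Z` a closed immersion with non-zero effective
  Cartier kernel": regularity `IsBlowup.isRegular_of_isRegular_subscheme`, integrality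
  `IsBlowup.isIntegral`, dimension `IsBlowup.topologicalKrullDim_le`, kernel
  `blowup.ker_pushforwardMap_eq_strictTransformIdeal` (part 1, `…Corridor3StrictTransformKernel`).

## Sources
* J. Kollár, *Lectures on Resolution of Singularities* (2007), 3.30.2–3.30.3. [Kollar2007]
* U. Görtz, T. Wedhorn, *Algebraic Geometry I*, 2nd ed. (2020), (13.19) p. 414, Prop. 13.96 (2).
  [GortzWedhorn2020]
* H. Matsumura, *Commutative Ring Theory* (1986), Thm. 20.3. [Matsumura1987]
-/

set_option linter.dupNamespace false -- mandated namespace of this single-conjunct summit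

noncomputable section

open CategoryTheory CategoryTheory.Limits AlgebraicGeometry TopologicalSpace
open Literature.AlgebraicGeometry.Resolution

namespace Summit.ResolutionOfSingularities.ResolutionOfSingularities.Theorems.SigmaMaxModificationsCorridor3.Helpers

universe u

/-! ## Saturation of a principal ideal by a principal ideal in a UFD -/

section UFD

open UniqueFactorizationMonoid

variable {R : Type*} [CommRing R]

/-- `r ∈ ((a) : (t)ⁿ)` iff `a ∣ r tⁿ`. [folklore] -/
theorem mem_colon_span_singleton_pow_iff (a t : R) (n : ℕ) (r : R) :
    r ∈ (Ideal.span {a}).colon ((Ideal.span {t} ^ n : Ideal R) : Set R) ↔ a ∣ r * t ^ n := by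
  rw [Ideal.span_singleton_pow, Submodule.mem_colon]
  constructor
  · intro h
    have := h (t ^ n) (Ideal.mem_span_singleton_self _)
    rwa [smul_eq_mul, Ideal.mem_span_singleton] at this
  · intro h s hs
    obtain ⟨c, rfl⟩ := Ideal.mem_span_singleton'.mp hs
    rw [smul_eq_mul, Ideal.mem_span_singleton]
    calc a ∣ r * t ^ n := h
      _ ∣ r * (c * t ^ n) := by rw [mul_left_comm]; exact dvd_mul_left _ _

variable [IsDomain R] [UniqueFactorizationMonoid R]

/-- **In a unique factorisation domain the saturation `⋃ₙ ((a) : (t)ⁿ)` of a non-zero principal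
ideal `(a)` by a principal ideal `(t)` is principal**, generated by a divisor of `a` (remove from
`a` the prime factors dividing `t`; induction on the factorisation of `a`). [folklore] -/
theorem exists_iSup_colon_span_singleton_pow_eq_span (t : R) :
    ∀ a : R, a ≠ 0 → ∃ g : R, g ≠ 0 ∧ g ∣ a ∧
      (⨆ n : ℕ, (Ideal.span {a}).colon ((Ideal.span {t} ^ n : Ideal R) : Set R)) =
        Ideal.span {g} := by
  intro a
  induction a using induction_on_prime with
  | h₁ => intro h; exact absurd rfl h
  | h₂ u hu =>
    intro _
    refine ⟨u, hu.ne_zero, dvd_rfl, ?_⟩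
    rw [Ideal.span_singleton_eq_top.mpr hu]
    refine le_antisymm le_top ?_
    refine le_trans ?_ (le_iSup _ 0)
    intro r _
    rw [Submodule.mem_colon]
    intro s _
    trivial
  | h₃ b p hb hp ih =>
    intro _
    obtain ⟨g, hg0, hgb, hgeq⟩ := ih hb
    by_cases hpt : p ∣ t
    · -- `p ∣ t`: the saturations of `(p b)` and `(b)` agree
      refine ⟨g, hg0, hgb.trans (dvd_mul_left b p), ?_⟩
      rw [← hgeq]
      apply le_antisymm
      · refine iSup_mono fun n => ?_
        intro r hr
        rw [mem_colon_span_singleton_pow_iff] at hr ⊢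
        exact (dvd_mul_left b p).trans hr
      · refine iSup_le fun n => le_trans ?_ (le_iSup _ (n + 1))
        intro r hr
        rw [mem_colon_span_singleton_pow_iff] at hr ⊢
        obtain ⟨t', ht'⟩ := hpt
        obtain ⟨c, hc⟩ := hr
        refine ⟨c * t', ?_⟩
        rw [pow_succ, ← mul_assoc, hc, ht']
        ring
    · -- `p ∤ t`: the saturation of `(p b)` is `p` times that of `(b)`
      refine ⟨p * g, mul_ne_zero hp.ne_zero hg0, mul_dvd_mul_left p hgb, ?_⟩
      have key : ∀ n : ℕ, (Ideal.span {p * b}).colon ((Ideal.span {t} ^ n : Ideal R) : Set R) =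
          Ideal.span {p} * (Ideal.span {b}).colon ((Ideal.span {t} ^ n : Ideal R) : Set R) := by
        intro n
        apply le_antisymm
        · intro r hr
          rw [mem_colon_span_singleton_pow_iff] at hr
          have hpr : p ∣ r := by
            have h1 : p ∣ r * t ^ n := (dvd_mul_right p b).trans hr
            rcases hp.dvd_or_dvd h1 with h | h
            · exact h
            · exact absurd (hp.dvd_of_dvd_pow h) hpt
          obtain ⟨r', rfl⟩ := hpr
          have hr' : b ∣ r' * t ^ n := by
            rw [mul_assoc] at hr
            exact (mul_dvd_mul_iff_left hp.ne_zero).mp hr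
          exact Ideal.mul_mem_mul (Ideal.mem_span_singleton_self p)
            ((mem_colon_span_singleton_pow_iff b t n r').mpr hr')
        · rw [Ideal.mul_le]
          intro x hx y hy
          obtain ⟨x', rfl⟩ := Ideal.mem_span_singleton'.mp hx
          rw [mem_colon_span_singleton_pow_iff] at hy ⊢
          rw [mul_comm x' p, mul_assoc, mul_assoc]
          exact mul_dvd_mul_left p (hy.trans (dvd_mul_left _ _))
      simp_rw [key]
      rw [← Ideal.mul_iSup, hgeq, Ideal.span_singleton_mul_span_singleton]

end UFD

/-! ## The strict transform of an effective Cartier divisor is an effective Cartier divisor -/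

section Cartier

variable {X X' : Scheme.{u}} [IsIntegral X] [IsLocallyNoetherian X] {π : X' ⟶ X}
  {C H : X.IdealSheafData}

omit [IsLocallyNoetherian X] in
/-- A blow-up of an integral scheme along a non-zero ideal sheaf is dominant (it is an
isomorphism over the dense open complement of the centre). [folklore] -/
theorem isDominant_of_isBlowup (hπ : IsBlowup π C) (hC : C ≠ ⊥) : IsDominant π := by
  refine ⟨?_⟩
  set W : X.Opens := ⟨(C.support : Set X)ᶜ, C.support.isClosed.isOpen_compl⟩ with hW
  haveI : IsIso (π ∣_ W) := hπ.isIso_compl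
  have hne : (W : Set X).Nonempty := by
    by_contra h
    apply hC
    rw [← Scheme.IdealSheafData.support_eq_top_iff]
    apply le_antisymm le_top
    intro x _
    by_contra hx
    exact h ⟨x, hx⟩
  have hdense : Dense (W : Set X) := W.isOpen.dense hne
  refine hdense.mono ?_
  intro x hx
  exact exists_apply_eq_of_isIso_morphismRestrict π W hx

/-- **The strict transform of an effective Cartier divisor under a blow-up with regular total
space is an effective Cartier divisor** (and non-zero). Let `X` be integral and locally
Noetherian, `π : X' → X` a blow-up along `C ≠ 0` with `X'` regular, and `H` an effective Cartier
ideal sheaf on `X`. Then `Q = ⋃ₙ (π^*H : 𝓘(D)ⁿ)` is effective Cartier and `Q ≠ 0`: at `x' ∈ X'`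
the stalk of `Q` is the saturation `⋃ₙ ((a) : (t)ⁿ)` of the (non-zero, `π` being dominant)
pulled-back equation `a` by the equation `t` of the exceptional divisor
(`stalkIdeal_strictTransformIdeal`), which is principal in the factorial local ring `𝒪_{X',x'}`
(Auslander–Buchsbaum, `uniqueFactorizationMonoid_of_isRegularLocalRing`;
`exists_iSup_colon_span_singleton_pow_eq_span`); a stalkwise principal non-zero ideal sheaf on an
integral locally Noetherian scheme is effective Cartier (`isEffectiveCartier_of_stalkIdeal_eq_span_singleton`).
[cite: GortzWedhorn2020, (13.19) p. 414] [cite: Matsumura1987, Thm. 20.3] -/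
theorem isEffectiveCartier_strictTransformIdeal (hπ : IsBlowup π C) (hC : C ≠ ⊥)
    (hX' : Scheme.IsRegular X') (hH : IsEffectiveCartier H) :
    IsEffectiveCartier (strictTransformIdeal π C H) ∧ strictTransformIdeal π C H ≠ ⊥ := by
  haveI : IsProper π := hπ.isProper
  haveI : IsLocallyNoetherian X' := LocallyOfFiniteType.isLocallyNoetherian π
  haveI : IsIntegral X' := hπ.isIntegral hC
  haveI : IsDominant π := isDominant_of_isBlowup hπ hC
  haveI : IsSchemeTheoreticallyDominant π := IsSchemeTheoreticallyDominant.of_isDominant π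
  have key : ∀ x' ∈ (strictTransformIdeal π C H).support, ∃ g : X'.presheaf.stalk x', g ≠ 0 ∧
      stalkIdeal (strictTransformIdeal π C H) x' = Ideal.span {g} := by
    intro x' hx'
    obtain ⟨U, hxU, f, hf, hHU⟩ := hH (π x')
    obtain ⟨V, hxV, t₀, -, hDV⟩ := hπ.isEffectiveCartier x'
    have hHst : stalkIdeal H (π x') = Ideal.span {(X.presheaf.germ U _ hxU).hom f} := by
      rw [stalkIdeal_eq_map_germ H U hxU, hHU, Ideal.map_span, Set.image_singleton]
    have hDst : stalkIdeal (C.comap π) x' = Ideal.span {(X'.presheaf.germ V _ hxV).hom t₀} := by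
      rw [stalkIdeal_eq_map_germ _ V hxV, hDV, Ideal.map_span, Set.image_singleton]
    set a : X'.presheaf.stalk x' := (π.stalkMap x').hom ((X.presheaf.germ U _ hxU).hom f) with ha_def
    set t : X'.presheaf.stalk x' := (X'.presheaf.germ V _ hxV).hom t₀ with ht_def
    have hQst : stalkIdeal (strictTransformIdeal π C H) x' =
        ⨆ n : ℕ, (Ideal.span {a}).colon ((Ideal.span {t} ^ n : Ideal _) : Set _) := by
      rw [stalkIdeal_strictTransformIdeal, hHst, hDst, Ideal.map_span, Set.image_singleton]
    -- `a ≠ 0`: `π` is (scheme-theoretically) dominant and germs are injective on the integral `X'`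
    have ha : a ≠ 0 := by
      haveI : Nonempty U := ⟨⟨π x', hxU⟩⟩
      have hf0 : f ≠ 0 := nonZeroDivisors.ne_zero hf
      intro h0
      apply hf0
      have h1 : (X'.presheaf.germ (π ⁻¹ᵁ U) x' hxU).hom ((π.app U).hom f) = 0 := by
        rw [ha_def] at h0
        change (π.stalkMap x') ((X.presheaf.germ U (π x') hxU) f) = 0 at h0
        rw [Scheme.Hom.germ_stalkMap_apply] at h0
        exact h0
      have h2 : (π.app U).hom f = 0 :=
        germ_injective_of_isIntegral X' x' (U := π ⁻¹ᵁ U) hxU (by rw [h1, map_zero])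
      exact π.app_injective U (by rw [h2, map_zero])
    -- the factorial local ring `𝒪_{X',x'}`
    haveI : IsRegularLocalRing (X'.presheaf.stalk x') := hX' x'
    haveI : IsDomain (X'.presheaf.stalk x') := isDomain_of_isRegularLocalRing _
    haveI : UniqueFactorizationMonoid (X'.presheaf.stalk x') :=
      uniqueFactorizationMonoid_of_isRegularLocalRing _ (hX' x')
    obtain ⟨g, hg0, -, hg⟩ := exists_iSup_colon_span_singleton_pow_eq_span t a ha
    exact ⟨g, hg0, hQst.trans hg⟩
  refine ⟨isEffectiveCartier_of_stalkIdeal_eq_span_singleton key, ?_⟩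
  intro hbot
  obtain ⟨x'⟩ := (inferInstance : Nonempty X')
  have hx' : x' ∈ (strictTransformIdeal π C H).support := by
    rw [hbot, Scheme.IdealSheafData.support_bot]; trivial
  obtain ⟨g, hg0, hg⟩ := key x' hx'
  rw [hbot, stalkIdeal_bot, eq_comm, Ideal.span_singleton_eq_bot] at hg
  exact hg0 hg

end Cartier

/-! ## One step of the embedded tower -/

section Tower

variable {k : Type u} [Field k]

/-- **One step of the embedded tower.** Let `ι : U ↪ Z` be a closed immersion onto the effective
Cartier divisor `V(I)` (`ker ι = I ≠ 0`) of a regular integral `Z`, separated, quasi-compact and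
locally of finite type over `k`, of dimension `≤ N`, and let `V(C') ⊆ U` be a regular centre. Blow
up: `π : Z₁ = Bl_{ι_* C'} Z → Z`, `U₁ = Bl_{C'} U`, Kollár's natural inclusion
`ι₁ : U₁ ↪ Z₁` (`blowup.pushforwardMap`). Then `(Z₁, U₁, ι₁)` is a configuration of the same
kind: `Z₁` is regular (`IsBlowup.isRegular_of_isRegular_subscheme`), integral
(`IsBlowup.isIntegral`), of dimension `≤ N` (`IsBlowup.topologicalKrullDim_le`), proper over `Z`,
and `ker ι₁` — the strict transform ideal `⋃ₙ (π^*I : 𝓘(D)ⁿ)`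
(`blowup.ker_pushforwardMap_eq_strictTransformIdeal`) — is a non-zero effective Cartier ideal
sheaf (`isEffectiveCartier_strictTransformIdeal`). [cite: Kollar2007, 3.30.2–3.30.3]
[cite: GortzWedhorn2020, Prop. 13.96 (2)] -/
theorem embeddedTower_step {U Z : Scheme.{u}} (h : Z ⟶ Spec (.of k)) [IsSeparated h]
    [LocallyOfFiniteType h] [QuasiCompact h] [IsIntegral Z] (hZ : Scheme.IsRegular Z) {N : ℕ}
    (hdim : topologicalKrullDim Z ≤ (N : WithBot ℕ∞)) {I : Z.IdealSheafData} (hI0 : I ≠ ⊥)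
    (hI : IsEffectiveCartier I) (ι : U ⟶ Z) [IsClosedImmersion ι] (hker : ι.ker = I)
    (C' : U.IdealSheafData) (hC' : Scheme.IsRegular C'.subscheme) :
    IsSeparated (blowup.π (C'.map ι) ≫ h) ∧ LocallyOfFiniteType (blowup.π (C'.map ι) ≫ h) ∧
      QuasiCompact (blowup.π (C'.map ι) ≫ h) ∧ IsIntegral (blowup (C'.map ι)) ∧
      Scheme.IsRegular (blowup (C'.map ι)) ∧
      topologicalKrullDim (blowup (C'.map ι)) ≤ (N : WithBot ℕ∞) ∧
      (blowup.pushforwardMap C' ι).ker ≠ ⊥ ∧ IsEffectiveCartier (blowup.pushforwardMap C' ι).ker := by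
  haveI : IsLocallyNoetherian Z := LocallyOfFiniteType.isLocallyNoetherian h
  have hb : IsBlowup (blowup.π (C'.map ι)) (C'.map ι) := blowup.isBlowup (C'.map ι)
  haveI : IsProper (blowup.π (C'.map ι)) := hb.isProper
  have hC0 : C'.map ι ≠ ⊥ := by
    intro h0
    apply hI0
    rw [← hker]
    exact le_bot_iff.mp (h0 ▸ ker_le_map C' ι)
  haveI : IsIntegral (blowup (C'.map ι)) := hb.isIntegral hC0
  have hreg : Scheme.IsRegular (blowup (C'.map ι)) :=
    IsBlowup.isRegular_of_isRegular_subscheme hZ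
      ((isRegular_subscheme_map_iff_of_isClosedImmersion ι C').mpr hC') hb
  have hcart := isEffectiveCartier_strictTransformIdeal (H := I) hb hC0 hreg hI
  rw [← hker, ← blowup.ker_pushforwardMap_eq_strictTransformIdeal] at hcart
  exact ⟨inferInstance, inferInstance, inferInstance, inferInstance, hreg,
    hb.topologicalKrullDim_le hdim, hcart.2, hcart.1⟩

/-- **The embedded tower along a regular-centred blow-up sequence** (Kollár 3.30.3 push-forward
`j_* B` with its natural inclusions `j_i : S_i ↪ X_i`, tree `CentreSeq.pushforward` /
`pushforwardι`), carrying the hypersurface package: for `ι : U ↪ Z` as in `embeddedTower_step`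
and a blow-up sequence `r` of `U` in regular centres, the top `r.top` embeds as a non-zero
effective Cartier divisor into a regular integral `Z'` of the same kind, compatibly with the
structure morphisms (induction along `r`, one `embeddedTower_step` per centre).
[cite: Kollar2007, 3.30.3] [cite: GortzWedhorn2020, Prop. 13.96 (2)] -/
theorem embeddedTower : ∀ {U : Scheme.{u}} (r : CentreSeq U) {Z : Scheme.{u}}
    (h : Z ⟶ Spec (.of k)) [IsSeparated h] [LocallyOfFiniteType h] [QuasiCompact h],
    IsIntegral Z → Scheme.IsRegular Z → ∀ {N : ℕ}, topologicalKrullDim Z ≤ (N : WithBot ℕ∞) →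
    ∀ (I : Z.IdealSheafData), I ≠ ⊥ → IsEffectiveCartier I → ∀ (ι : U ⟶ Z) [IsClosedImmersion ι],
    ι.ker = I → r.AllRegular →
    ∃ (Z' : Scheme.{u}) (h' : Z' ⟶ Spec (.of k)) (I' : Z'.IdealSheafData) (ι' : r.top ⟶ Z'),
      IsSeparated h' ∧ LocallyOfFiniteType h' ∧ QuasiCompact h' ∧ IsIntegral Z' ∧
      Scheme.IsRegular Z' ∧ topologicalKrullDim Z' ≤ (N : WithBot ℕ∞) ∧ I' ≠ ⊥ ∧
      IsEffectiveCartier I' ∧ IsClosedImmersion ι' ∧ ι' ≫ h' = r.comp ≫ ι ≫ h ∧ ι'.ker = I'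
  | _, CentreSeq.nil _, Z, h, _, _, _, hZi, hZ, _, hdim, I, hI0, hI, ι, hι, hker, _ =>
    ⟨Z, h, I, ι, inferInstance, inferInstance, inferInstance, hZi, hZ, hdim, hI0, hI, hι,
      by simp [CentreSeq.comp], hker⟩
  | _, CentreSeq.cons C' rest, Z, h, _, _, _, hZi, hZ, N, hdim, I, hI0, hI, ι, hι, hker, hr => by
    obtain ⟨hsep, hlft, hqc, hint, hreg, hdim₁, hker0, hcart⟩ :=
      embeddedTower_step h hZ hdim hI0 hI ι hker C' hr.1
    haveI := hsep; haveI := hlft; haveI := hqc; haveI := hint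
    obtain ⟨Z', h', I', ι', hs', hl', hq', hi', hr', hd', hI0', hI', hι', hcomp, hker'⟩ :=
      embeddedTower rest (blowup.π (C'.map ι) ≫ h) hint hreg hdim₁ _ hker0 hcart
        (blowup.pushforwardMap C' ι) rfl hr.2
    refine ⟨Z', h', I', ι', hs', hl', hq', hi', hr', hd', hI0', hI', hι', hcomp.trans ?_, hker'⟩
    change rest.comp ≫ blowup.pushforwardMap C' ι ≫ blowup.π (C'.map ι) ≫ h =
      (rest.comp ≫ blowup.π C') ≫ ι ≫ h
    rw [blowup.pushforwardMap_π_assoc, Category.assoc]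

/-- **[OURS · L1 W4.2] T3 — the embedded tower (lead-1's brick, hypothesis `hT3` of the kernel
assembly `TameWild.confinedNu3_of_bricks`, p480768, signature verbatim).** Let `ι : U ↪ Z` be a
closed immersion over `k` whose kernel `I ≠ 0` is an effective Cartier ideal sheaf of a regular
integral `Z` (separated, quasi-compact, locally of finite type over `k`, `dim Z ≤ 4`), and `r` a
blow-up sequence of `U` in regular centres. Then `r.top` embeds, compatibly with the structure
morphisms, as a non-zero effective Cartier divisor `V(I')` in a regular integral `Z'` of the same
kind: the top of Kollár's push-forward tower `r_* ` along `ι` (`embeddedTower`).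
[cite: Kollar2007, 3.30.2–3.30.3] [cite: GortzWedhorn2020, Prop. 13.96 (2)] -/
theorem stub_T3_embeddedTower (k : Type) [Field k] (U Z : Scheme.{0}) (h : Z ⟶ Spec (.of k))
    [IsSeparated h] [LocallyOfFiniteType h] [QuasiCompact h] (hZi : IsIntegral Z)
    (hZ : Scheme.IsRegular Z) (hdim : topologicalKrullDim Z ≤ ((4 : ℕ) : WithBot ℕ∞))
    (I : Z.IdealSheafData) (hI0 : I ≠ ⊥) (hI : IsEffectiveCartier I) (ι : U ⟶ Z)
    [IsClosedImmersion ι] (hker : ι.ker = I) (r : CentreSeq U) (hr : r.AllRegular) :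
    ∃ (Z' : Scheme.{0}) (h' : Z' ⟶ Spec (.of k)) (I' : Z'.IdealSheafData) (ι' : r.top ⟶ Z'),
      IsSeparated h' ∧ LocallyOfFiniteType h' ∧ QuasiCompact h' ∧ IsIntegral Z' ∧
      Scheme.IsRegular Z' ∧ topologicalKrullDim Z' ≤ ((4 : ℕ) : WithBot ℕ∞) ∧ I' ≠ ⊥ ∧
      IsEffectiveCartier I' ∧ IsClosedImmersion ι' ∧ ι' ≫ h' = r.comp ≫ ι ≫ h ∧
      ι'.ker = I' :=
  embeddedTower r h hZi hZ hdim I hI0 hI ι hker hr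

end Tower

end Summit.ResolutionOfSingularities.ResolutionOfSingularities.Theorems.SigmaMaxModificationsCorridor3.Helpers

end
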